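import Summits.FinalStateConjecture.FinalStateConjecture.Theses.ExactKerrEnds
import Summits.FinalStateConjecture.FinalStateConjecture.Theorems.ExactKerrEndsSettlingAlongCensoredKerrEndsGaugeBorneUpgrade
import Literature.Geometry.Lorentzian.ExactKerrEnd

/-!
# Line `wall-cone-sections` for the crux `ExactKerrEnds.SettlingAlongCensoredKerrEnds`
# (stmt-FinalStateConjecture-18520) — lead's skeleton, cycle 1 (2026-08-17)

Registered skeleton: `Cruxes/SettlingAlongCensoredKerrEnds/Lines/wall_cone_sections.lean`
(crux-strategist s2; stubs GU `stub_gaugeBorneUpgrade` + PW `stub_lipschitzWallsInKickUnfolding`,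
composition `SettlingAlongCensoredKerrEnds_of` proved). State after the lead's first integration:

* **GU is CLOSED**: `Summit.FinalStateConjecture.FinalStateConjecture.Theorems.ExactKerrEnds.stub_gaugeBorneUpgrade`
  (Theorems/ExactKerrEndsSettlingAlongCensoredKerrEndsGaugeBorneUpgrade.lean, p164931, prover seat 0,
  2026-08-17T14:03Z) proves the registered signature verbatim (gauged family = breathing of the
  quadratically reparametrised curve; injectivity on a window). The composition below uses it BY NAME;
  the local sorried copy is gone.
* **PW is RESHAPED to the form the composition actually consumes — the settled WEDGE**
  (`stub_settledWedgeInKickUnfolding`, the only `sorry` of this file): along the given censored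
  Kerr-ended curve `F` there is a tame admissible two-parameter unfolding `G` (`G (t, 0) = F t`), a
  slope `K` and a box `0 < t ≤ t₁`, `s < b₀` such that every member `G (t, s)` of the open wedge
  `K t < s < b₀` above the cone is SETTLED (the Statement's settling clause for every maximal
  development, verbatim). The strategist's Lipschitz-walls statement PW implies it
  (`settledWedge_of_lipschitzWalls`, proved: `K`-Lipschitz walls through the origin lie in `|s| ≤ K t`),
  so a proof of PW closes the wedge stub in one line, while a LAMINATION of walls of bounded slope at
  the corner (the LaminatedThreshold-type negation N5 of STRATEGY-CENSUS, which kills PW's "finitely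
  many") does NOT kill the wedge: only an exceptional set reaching the corner with VERTICAL tangent
  (non-settled kicked members `G (tₙ, sₙ)` with `tₙ → 0` and `sₙ / tₙ → ∞`, `sₙ → 0`) does. The walls
  remain the intended MECHANISM and the refuters' itemised target; the wedge is the registered
  obligation.
* The composition `SettlingAlongCensoredKerrEnds_of` is re-proved from the wedge: the ray
  `s = (K + 1) t` lies in the wedge, `t = t₂ c² / (1 + c²)` runs along it from both signs of `c`
  (`IsTameDataFamily.comp_contDiff`), and GU (landed) makes the resulting tame admissible settled
  curve through `F 0` injective and immersed.

Disproof used: no `Cruxes/SettlingAlongCensoredKerrEnds/Disproof.lean` exists at 2026-08-17T14:10Z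
(`ledger crux ls`). Honoured: `settlingAlongCensoredKerrEnds_false_without_isMaximal_of` (Shape.lean,
p153938: the wedge stub quantifies the settling clause over maximal developments verbatim);
`settlingAlongCensoredKerrEnds_iff_finalStateConjecture` (p144597/p162701: the crux as typed is
summit-strength at the base datum — the wedge localises that residue at the corner of ONE transversal
2-slice through the members of `F`); NegativeNote_EssentialWallCrossings (void for cone rays: the
amplitude `(K+1) t` majorises every excursion of slope `≤ K`).
-/

noncomputable section

set_option linter.dupNamespace false

open Set Function Filter Topology TopologicalSpace
open scoped ENNReal NNReal Topology Manifold ContDiff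
open Literature.Geometry.Lorentzian

namespace Summit.FinalStateConjecture.FinalStateConjecture.Cruxes.SettlingAlongCensoredKerrEnds.WallConeSections

/-! ### The registered stub (the only `sorry`) -/

/-- **Stub W — a settled wedge in a one-sided kick-unfolding of a censored Kerr-ended curve.**
For every `X`, end `e` and tame curve `F` of admissible data on `e`, immersed-injective or constant,
whose members off `0` are Kerr-ended (`HasExactKerrEnd`) and censored (every MGHD has complete 𝓘⁺),
there are an end `e'`, a tame admissible TWO-parameter family `G` on `e'` UNFOLDING `F`
(`G (t, 0) = F t`, points of `ℝ²` written `t • e₀ + s • e₁`), a slope `K ≥ 0` and a box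
`0 < t ≤ t₁`, `s < b₀` (`0 < t₁`, `0 < b₀`) such that every member `G (t, s)` of the open WEDGE
`K t < s < b₀` is SETTLED (the Statement's settling clause for every maximal development, verbatim).
Informally: kick the censored Kerr-ended members `F t`, `t ≠ 0` (compactly supported admissible
deformation of one sign, transversal to the extremal-threshold / censorship sheets through `F 0`;
Kerr-endedness survives, `HasExactKerrEnd.of_eq_off_compact`); the non-settled kicked members near the
corner are expected to lie on C¹ wall traces through `F 0` with non-vertical tangents (extremal
thresholds: Kehle–Unger arXiv:2402.10190 §1.4, Angelopoulos–Kehle–Unger arXiv:2603.10378 Thm 2;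
censorship walls: Christodoulou CQG 16 (1999) A23), hence inside a cone `|s| ≤ K t`, and above the
cone the kicked members are captured, strictly sub-extremal and settle in C² (Hintz arXiv:2606.28253
Thm 1.1 is posed on exactly this data class). Weakest form used by the line's composition; implied by
the strategist's Lipschitz-walls statement PW (`settledWedge_of_lipschitzWalls`). Open-problem sized:
it contains the large-data settling problem for the kicked members and the non-verticality of the
exceptional set at the corner. -/
theorem stub_settledWedgeInKickUnfolding :
    ∀ (X : Type) [TopologicalSpace X] [ChartedSpace E3 X] [IsManifold (𝓡 3) ∞ X] [T2Space X]
      [SecondCountableTopology X] [ConnectedSpace X],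
      ∀ (e : AFEnd X) (F : EuclideanSpace ℝ (Fin 1) → InitialDataSet (𝓡 3) X),
        InitialDataSet.IsTameDataFamily e 1 F →
          ((InitialDataSet.IsImmersedAtZero 1 F ∧ Injective F) ∨ ∀ c, F c = F 0) →
            (∀ c, F c ∈ admissibleVacuumData X) →
              (∀ c ≠ 0, (F c).HasExactKerrEnd ∧
                ∀ 𝒟 : VacuumCauchyDevelopment (F c), 𝒟.IsMaximal →
                  Summit.FinalStateConjecture.HasCompleteNullInfinity 𝒟.toCauchyDevelopment) →
                ∃ (e' : AFEnd X) (G : EuclideanSpace ℝ (Fin 2) → InitialDataSet (𝓡 3) X)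
                  (K : ℝ≥0) (t₁ b₀ : ℝ),
                  InitialDataSet.IsTameDataFamily e' 2 G ∧
                    (∀ c : EuclideanSpace ℝ (Fin 1),
                      G ((c 0) • EuclideanSpace.single 0 (1 : ℝ) +
                          (0 : ℝ) • EuclideanSpace.single 1 (1 : ℝ)) = F c) ∧
                    (∀ p, G p ∈ admissibleVacuumData X) ∧ 0 < t₁ ∧ 0 < b₀ ∧
                    ∀ t ∈ Ioc (0 : ℝ) t₁, ∀ s : ℝ, (K : ℝ) * t < s → s < b₀ →
                      ∀ 𝒟 : VacuumCauchyDevelopment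
                          (G (t • EuclideanSpace.single 0 (1 : ℝ) + s • EuclideanSpace.single 1 (1 : ℝ))),
                        𝒟.IsMaximal →
                          Summit.FinalStateConjecture.HasCompleteNullInfinity 𝒟.toCauchyDevelopment ∧
                            ∃ (O : Set 𝒟.carrier) (d : FinalStateDecomposition 𝒟.toSpacetime O 2),
                              (∀ i, Kerr.IsSubextremal (d.mass i) (d.spin i)) ∧
                                O = Summit.FinalStateConjecture.exteriorOf 𝒟.toCauchyDevelopment
                                      d.charted ∧
                                  Summit.FinalStateConjecture.RaysStayInClosure
                                      𝒟.toCauchyDevelopment O ∧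
                                    Summit.FinalStateConjecture.HasExhaustiveCharts d ∧
                                      Summit.FinalStateConjecture.IsFutureOriented d := by
  sorry

/-! ### The strategist's Lipschitz-walls statement PW implies the wedge (proved) -/

/-- **Inside the cone.** A `K`-Lipschitz function through the origin satisfies `g t ≤ K t` for
`t > 0`; so every `s > K t` is off the wall `s = g t`. -/
theorem ne_wall_of_lt {K : ℝ≥0} {g : ℝ → ℝ} (hg : LipschitzWith K g) (hg0 : g 0 = 0) {t s : ℝ}
    (ht : 0 < t) (hs : (K : ℝ) * t < s) : s ≠ g t := by
  have h := hg.dist_le_mul t 0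
  rw [hg0, Real.dist_eq, Real.dist_eq, sub_zero, sub_zero, abs_of_pos ht] at h
  have h' : g t ≤ (K : ℝ) * t := le_trans (le_abs_self _) h
  intro heq
  rw [← heq] at h'
  exact absurd (lt_of_le_of_lt h' hs) (lt_irrefl _)

/-- **PW ⇒ W.** The registered Lipschitz-walls statement of the strategist's skeleton
(`stub_lipschitzWallsInKickUnfolding`: finitely many `K`-Lipschitz walls `s = g i t` through the origin
carry all non-settled members of the half-box `0 < t ≤ t₁`, `0 < s < b₀`) implies the wedge statement
with the same unfolding, slope and box: a point of the wedge `K t < s < b₀` is in the half-box and off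
every wall (`ne_wall_of_lt`). Hence whoever proves PW closes `stub_settledWedgeInKickUnfolding`. -/
theorem settledWedge_of_lipschitzWalls
    (hPW :
    ∀ (X : Type) [TopologicalSpace X] [ChartedSpace E3 X] [IsManifold (𝓡 3) ∞ X] [T2Space X]
      [SecondCountableTopology X] [ConnectedSpace X],
      ∀ (e : AFEnd X) (F : EuclideanSpace ℝ (Fin 1) → InitialDataSet (𝓡 3) X),
        InitialDataSet.IsTameDataFamily e 1 F →
          ((InitialDataSet.IsImmersedAtZero 1 F ∧ Injective F) ∨ ∀ c, F c = F 0) →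
            (∀ c, F c ∈ admissibleVacuumData X) →
              (∀ c ≠ 0, (F c).HasExactKerrEnd ∧
                ∀ 𝒟 : VacuumCauchyDevelopment (F c), 𝒟.IsMaximal →
                  Summit.FinalStateConjecture.HasCompleteNullInfinity 𝒟.toCauchyDevelopment) →
                ∃ (e' : AFEnd X) (G : EuclideanSpace ℝ (Fin 2) → InitialDataSet (𝓡 3) X)
                  (n : ℕ) (g : Fin n → ℝ → ℝ) (K : ℝ≥0) (t₁ b₀ : ℝ),
                  InitialDataSet.IsTameDataFamily e' 2 G ∧
                    (∀ c : EuclideanSpace ℝ (Fin 1),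
                      G ((c 0) • EuclideanSpace.single 0 (1 : ℝ) +
                          (0 : ℝ) • EuclideanSpace.single 1 (1 : ℝ)) = F c) ∧
                    (∀ p, G p ∈ admissibleVacuumData X) ∧
                    (∀ i, LipschitzWith K (g i)) ∧ (∀ i, g i 0 = 0) ∧ 0 < t₁ ∧ 0 < b₀ ∧
                    ∀ t ∈ Ioc (0 : ℝ) t₁, ∀ s : ℝ, 0 < s → s < b₀ → (∀ i, s ≠ g i t) →
                      ∀ 𝒟 : VacuumCauchyDevelopment
                          (G (t • EuclideanSpace.single 0 (1 : ℝ) + s • EuclideanSpace.single 1 (1 : ℝ))),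
                        𝒟.IsMaximal →
                          Summit.FinalStateConjecture.HasCompleteNullInfinity 𝒟.toCauchyDevelopment ∧
                            ∃ (O : Set 𝒟.carrier) (d : FinalStateDecomposition 𝒟.toSpacetime O 2),
                              (∀ i, Kerr.IsSubextremal (d.mass i) (d.spin i)) ∧
                                O = Summit.FinalStateConjecture.exteriorOf 𝒟.toCauchyDevelopment
                                      d.charted ∧
                                  Summit.FinalStateConjecture.RaysStayInClosure
                                      𝒟.toCauchyDevelopment O ∧
                                    Summit.FinalStateConjecture.HasExhaustiveCharts d ∧
                                      Summit.FinalStateConjecture.IsFutureOriented d) :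
    ∀ (X : Type) [TopologicalSpace X] [ChartedSpace E3 X] [IsManifold (𝓡 3) ∞ X] [T2Space X]
      [SecondCountableTopology X] [ConnectedSpace X],
      ∀ (e : AFEnd X) (F : EuclideanSpace ℝ (Fin 1) → InitialDataSet (𝓡 3) X),
        InitialDataSet.IsTameDataFamily e 1 F →
          ((InitialDataSet.IsImmersedAtZero 1 F ∧ Injective F) ∨ ∀ c, F c = F 0) →
            (∀ c, F c ∈ admissibleVacuumData X) →
              (∀ c ≠ 0, (F c).HasExactKerrEnd ∧
                ∀ 𝒟 : VacuumCauchyDevelopment (F c), 𝒟.IsMaximal →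
                  Summit.FinalStateConjecture.HasCompleteNullInfinity 𝒟.toCauchyDevelopment) →
                ∃ (e' : AFEnd X) (G : EuclideanSpace ℝ (Fin 2) → InitialDataSet (𝓡 3) X)
                  (K : ℝ≥0) (t₁ b₀ : ℝ),
                  InitialDataSet.IsTameDataFamily e' 2 G ∧
                    (∀ c : EuclideanSpace ℝ (Fin 1),
                      G ((c 0) • EuclideanSpace.single 0 (1 : ℝ) +
                          (0 : ℝ) • EuclideanSpace.single 1 (1 : ℝ)) = F c) ∧
                    (∀ p, G p ∈ admissibleVacuumData X) ∧ 0 < t₁ ∧ 0 < b₀ ∧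
                    ∀ t ∈ Ioc (0 : ℝ) t₁, ∀ s : ℝ, (K : ℝ) * t < s → s < b₀ →
                      ∀ 𝒟 : VacuumCauchyDevelopment
                          (G (t • EuclideanSpace.single 0 (1 : ℝ) + s • EuclideanSpace.single 1 (1 : ℝ))),
                        𝒟.IsMaximal →
                          Summit.FinalStateConjecture.HasCompleteNullInfinity 𝒟.toCauchyDevelopment ∧
                            ∃ (O : Set 𝒟.carrier) (d : FinalStateDecomposition 𝒟.toSpacetime O 2),
                              (∀ i, Kerr.IsSubextremal (d.mass i) (d.spin i)) ∧
                                O = Summit.FinalStateConjecture.exteriorOf 𝒟.toCauchyDevelopment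
                                      d.charted ∧
                                  Summit.FinalStateConjecture.RaysStayInClosure
                                      𝒟.toCauchyDevelopment O ∧
                                    Summit.FinalStateConjecture.HasExhaustiveCharts d ∧
                                      Summit.FinalStateConjecture.IsFutureOriented d := by
  intro X _ _ _ _ _ _ e F hF hdich h𝓓 hQ
  obtain ⟨e', G, n, g, K, t₁, b₀, hG, hGF, hGadm, hg, hg0, ht₁, hb₀, hgood⟩ :=
    hPW X e F hF hdich h𝓓 hQ
  refine ⟨e', G, K, t₁, b₀, hG, hGF, hGadm, ht₁, hb₀, fun t ht s hKs hsb ↦ ?_⟩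
  have hspos : 0 < s := lt_of_le_of_lt (mul_nonneg K.coe_nonneg ht.1.le) hKs
  exact hgood t ht s hspos hsb (fun i ↦ ne_wall_of_lt (hg i) (hg0 i) ht.1 hKs)

/-! ### The cone ray (proved real analysis) -/

/-- The even corner reparametrisation `x ↦ t₂ · x² / (1 + x²)`: smooth, `0` at `0`, values in
`(0, t₂)` off `0` (for `t₂ > 0`). -/
def cornerParam (t₂ x : ℝ) : ℝ := t₂ * (x ^ 2 / (1 + x ^ 2))

theorem contDiff_cornerParam (t₂ : ℝ) : ContDiff ℝ ∞ (cornerParam t₂) := by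
  unfold cornerParam
  refine contDiff_const.mul (ContDiff.div (contDiff_id.pow 2) (contDiff_const.add (contDiff_id.pow 2)) ?_)
  intro x
  positivity

theorem cornerParam_zero (t₂ : ℝ) : cornerParam t₂ 0 = 0 := by simp [cornerParam]

theorem cornerParam_pos {t₂ x : ℝ} (ht₂ : 0 < t₂) (hx : x ≠ 0) : 0 < cornerParam t₂ x := by
  unfold cornerParam
  have hx2 : 0 < x ^ 2 := by positivity
  positivity

theorem cornerParam_lt {t₂ : ℝ} (ht₂ : 0 < t₂) (x : ℝ) : cornerParam t₂ x < t₂ := by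
  unfold cornerParam
  have h1 : x ^ 2 / (1 + x ^ 2) < 1 := by
    rw [div_lt_one (by positivity)]
    linarith [sq_nonneg x]
  calc t₂ * (x ^ 2 / (1 + x ^ 2)) < t₂ * 1 := by exact mul_lt_mul_of_pos_left h1 ht₂
    _ = t₂ := mul_one t₂

/-! ### The composition (proved): GU (landed) → W → C₂ -/

/-- **The line concludes the crux BY NAME**: `SettlingAlongCensoredKerrEnds` from the registered
stub `stub_settledWedgeInKickUnfolding` (W, used by name) and the LANDED gauge-borne upgrade
`Theorems.ExactKerrEnds.stub_gaugeBorneUpgrade` (GU, p164931); everything else is proved here (the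
only `sorry` of the file is W's). Along the given curve `F`, W hands the unfolding `G`, the slope `K`
and the box; the ray `s = (K + 1) t`, `t = t₂ c² / (1 + c²)` with `t₂ := min t₁ (b₀ / (2 (K + 1)))`,
is a smooth parameter map `ℝ¹ → ℝ²` vanishing at `0` whose values off `0` lie in the wedge, so
`H c := G (ray c)` is a tame admissible curve through `F 0` (`IsTameDataFamily.comp_contDiff`) with
settled members off `0`; GU upgrades `H` to the injective immersed curve the crux asks for. -/
theorem SettlingAlongCensoredKerrEnds_of :
    Summit.FinalStateConjecture.FinalStateConjecture.Theses.ExactKerrEnds.SettlingAlongCensoredKerrEnds := by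
  have hGU := Summit.FinalStateConjecture.FinalStateConjecture.Theorems.ExactKerrEnds.stub_gaugeBorneUpgrade
  have hW := stub_settledWedgeInKickUnfolding
  intro X _ _ _ _ _ _ KerrEnded Censored Settled e F hF hdich h𝓓 hQ
  -- the members off `0` of `F` are Kerr-ended (legend = `HasExactKerrEnd`, definitionally) and censored
  have hQ' : ∀ c ≠ 0, (F c).HasExactKerrEnd ∧
      ∀ 𝒟 : VacuumCauchyDevelopment (F c), 𝒟.IsMaximal →
        Summit.FinalStateConjecture.HasCompleteNullInfinity 𝒟.toCauchyDevelopment := fun c hc ↦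
    ⟨(InitialDataSet.hasExactKerrEnd_iff (F c)).2 (hQ c hc).1, (hQ c hc).2⟩
  -- W: the unfolding, the slope, the box
  obtain ⟨e', G, K, t₁, b₀, hG, hGF, hGadm, ht₁, hb₀, hgood⟩ := hW X e F hF hdich h𝓓 hQ'
  -- the cone ray `s = (K+1) t`, `t = t₂ x²/(1+x²)`
  set κ : ℝ := (K : ℝ) + 1 with hκ
  have hκpos : 0 < κ := by rw [hκ]; positivity
  set t₂ : ℝ := min t₁ (b₀ / (2 * κ)) with ht₂
  have ht₂pos : 0 < t₂ := lt_min ht₁ (by positivity)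
  have ht₂le : t₂ ≤ t₁ := min_le_left _ _
  have ht₂b : κ * t₂ ≤ b₀ / 2 := by
    have : t₂ ≤ b₀ / (2 * κ) := min_le_right _ _
    calc κ * t₂ ≤ κ * (b₀ / (2 * κ)) := by exact mul_le_mul_of_nonneg_left this hκpos.le
      _ = b₀ / 2 := by field_simp
  let ray : EuclideanSpace ℝ (Fin 1) → EuclideanSpace ℝ (Fin 2) := fun c ↦
    (cornerParam t₂ (c 0)) • EuclideanSpace.single 0 (1 : ℝ) +
      (κ * cornerParam t₂ (c 0)) • EuclideanSpace.single 1 (1 : ℝ)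
  have h0 : ContDiff ℝ ∞ (fun c : EuclideanSpace ℝ (Fin 1) ↦ c 0) :=
    (EuclideanSpace.proj (0 : Fin 1) : EuclideanSpace ℝ (Fin 1) →L[ℝ] ℝ).contDiff
  have hφ : ContDiff ℝ ∞ (fun c : EuclideanSpace ℝ (Fin 1) ↦ cornerParam t₂ (c 0)) :=
    (contDiff_cornerParam t₂).comp h0
  have hray : ContDiff ℝ ∞ ray := (hφ.smul contDiff_const).add ((contDiff_const.mul hφ).smul contDiff_const)
  have hray0 : ray 0 = 0 := by
    simp [ray, cornerParam_zero]
  -- the handed-over (not yet immersed) curve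
  let H : EuclideanSpace ℝ (Fin 1) → InitialDataSet (𝓡 3) X := fun c ↦ G (ray c)
  have hH : InitialDataSet.IsTameDataFamily e' 1 H := hG.comp_contDiff hray hray0
  have hH0 : H 0 = F 0 := by
    have h1 : H 0 = G 0 := by simp only [H, hray0]
    have h2 := hGF 0
    have h3 : ((0 : EuclideanSpace ℝ (Fin 1)) 0) • EuclideanSpace.single (0 : Fin 2) (1 : ℝ) +
        (0 : ℝ) • EuclideanSpace.single (1 : Fin 2) (1 : ℝ) = 0 := by simp
    rw [h3] at h2
    exact h1.trans h2
  have hHadm : ∀ c, H c ∈ admissibleVacuumData X := fun c ↦ hGadm _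
  have hHgood : ∀ c ≠ 0, ∀ 𝒟 : VacuumCauchyDevelopment (H c), 𝒟.IsMaximal →
      Summit.FinalStateConjecture.HasCompleteNullInfinity 𝒟.toCauchyDevelopment ∧
        ∃ (O : Set 𝒟.carrier) (d : FinalStateDecomposition 𝒟.toSpacetime O 2),
          (∀ i, Kerr.IsSubextremal (d.mass i) (d.spin i)) ∧
            O = Summit.FinalStateConjecture.exteriorOf 𝒟.toCauchyDevelopment d.charted ∧
              Summit.FinalStateConjecture.RaysStayInClosure 𝒟.toCauchyDevelopment O ∧
                Summit.FinalStateConjecture.HasExhaustiveCharts d ∧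
                  Summit.FinalStateConjecture.IsFutureOriented d := by
    intro c hc
    have hc0 : c 0 ≠ 0 := by
      intro h
      apply hc
      ext i
      rw [Subsingleton.elim i 0, h]
      rfl
    have htpos : 0 < cornerParam t₂ (c 0) := cornerParam_pos ht₂pos hc0
    have htlt : cornerParam t₂ (c 0) < t₂ := cornerParam_lt ht₂pos (c 0)
    have htmem : cornerParam t₂ (c 0) ∈ Ioc (0 : ℝ) t₁ := ⟨htpos, (htlt.le.trans ht₂le)⟩
    have hKs : (K : ℝ) * cornerParam t₂ (c 0) < κ * cornerParam t₂ (c 0) := by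
      apply mul_lt_mul_of_pos_right _ htpos
      rw [hκ]
      linarith
    have hslt : κ * cornerParam t₂ (c 0) < b₀ := by
      have : κ * cornerParam t₂ (c 0) < κ * t₂ := mul_lt_mul_of_pos_left htlt hκpos
      linarith
    exact hgood _ htmem _ hKs hslt
  -- GU: immersion and injectivity are gauge-borne
  obtain ⟨e'', F', hF', hF'0, hinj, himm, hadm', hgood'⟩ := hGU X e' H hH hHadm hHgood
  exact ⟨e'', F', hF', hF'0.trans hH0, hinj, himm, hadm', fun c hc ↦ hgood' c hc⟩

end Summit.FinalStateConjecture.FinalStateConjecture.Cruxes.SettlingAlongCensoredKerrEnds.WallConeSections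

end
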